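import Mathlib
import Literature.NumberTheory.LFunctions.Zhang2022.SkeletonWholeDAGv43
import Literature.NumberTheory.LFunctions.Zhang2022.Section18MainOrderE
import HarnessLib

/-!
# Zhang (2022), rescue gap table (D-0124 (4)): the endgame CURRENCY families, their monotonicity, and the
# HAVE-side of the (2.32)/(2.33) nodes as tree theorems

Topic `Literature/NumberTheory/LFunctions/Zhang2022` (Landau–Siegel audit tree; verdict-neutral).
Y. Zhang, *Discrete mean estimates and the Landau–Siegel zero*, arXiv:2211.02515v1 (2022)
[Zhang2022LandauSiegel] — **an unrefereed manuscript under adjudication; nothing in this file asserts or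
denies its Theorems 1–2, and nothing here is a claim about Landau–Siegel zeros.**

Purpose (LS rescue protocol, «quantified gap table»: at each step the constant NEEDED vs the constant the
tree HAS). For the endgame rows the currencies are main-term constants: the node (2.32) lives in the family
`Skeleton.Ineq232With c′ q` («`Ξ₁ ≤ (q+η)𝔞𝔓` eventually under (A)»), (2.33) in `Skeleton.Ineq233With c′ c_J`,
the evaluations (8.23)/(9.7)/(10.17) in the POINT families `Eval823With c′ k` / `Skeleton.Eval97With c′ k` /
`Eval1017With c′ d`, and the terminal step in `MainOrderContradiction c₂₃₂ c₂₃₃`. This file records: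

* the two evaluation families not yet in the tree, `Eval823With`, `Eval1017With` (the desk certificate
  `RepairNodeJunk.lean` of the tribunal desk, namespace `T1ProbeLS.RepairNodes`, states them; `Eval97With` is
  the tree's `SkeletonEval97cL102Rel`), with `Iff.rfl` bridges to the skeleton's instances;
* MONOTONICITY in the currency: `ineq232With_mono` (in `q`), `ineq233With_mono` (in `c_J`) — proofs after the
  desk certificate — and `mainOrderContradiction_anti` (the terminal predicate is antitone in both constants);
* the HAVE side as theorems: for every large `c′`, `Ineq232With c′ q` for every `q ≥ c₂₃₂ᴱ := c232E e1ppD 𝔠₂ᶜ`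
  (`< 0.055363`) and `Ineq233With c′ c_J` for every `c_J ≥ C₂₃₃` (`< 2546.8478`), from the margin-free
  `Skeleton.sec2_inputs_hold`; numerals `ineq232With_have`, `ineq233With_have`, `ineq233With_printed`;
* the NEEDED side restated in the same currencies: `MainOrderContradiction q C233` fails for `q ≥ 0.011026`
  (tree) — so in currency `q` the row reads NEEDED `< 0.011026`, HAVE `≥ 0.055348`.

* (rev 2) the EXPONENT-PAIR currency of the `ℓ₀ = 1` edge (GAP rows G-11/G-32): the ℓ-window system
  `EllWindow A₀ A_max c_crit r c A B` with the kernel twin of the rescue's kit LP-1 — generic emptiness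
  `not_ellWindow_of_ratio_le` (tie × ceiling ≤ 1/2), the census instance `EllWindowV19` (ELL-CENSUS v1.9 numbers
  as arguments, not facts), `not_ellWindowV19_ordered/printExact/of_ratio_le`, sharpness `ellWindowV19_of_lt_ratio`,
  `ellWindowV19_deficits` (drafted by ls-rescue-quant-1).

* (rev 3) the BAND-SEAM currency (GAP row G-21 / OPT-AUDIT N17): `bandMassExp`, `discWeightExp`, `bandRoom`
  (`= x_P − 3`), `genericLoss` (`= w + x_P`), `genericLoss_sub_bandRoom` (deficit `= w + 3`, `x_P`-free),
  `three_le_genericLoss_sub_bandRoom`, `not_genericLoss_lt_bandRoom`, `genericLoss_lt_bandRoom_iff` (`↔ w < −3`);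
  printed numerals (room 6, loss 77, deficit 71). Drafted by ls-rescue-quant-1 g1.

Deliberately NOT here: the desk certificate's «`↔ EvNotA`» restatement theorems (a node asserted BELOW the
tree's two-sided evaluation restates ¬(A)-eventually) — cite the certificate; no statement about Theorems 1–2.

## References

* Y. Zhang, arXiv:2211.02515v1 (2022), §2 (2.32)–(2.33) p. 6, §8 (8.23), §10 (10.17), §18.
  [cite: Zhang2022LandauSiegel, §§2, 8, 10, 18]
-/

noncomputable section

open Complex Real

namespace Literature.NumberTheory.LFunctions.Zhang2022.Repair.Gap

open Skeleton

/-! ## The two evaluation families missing from the tree -/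

/-- **(8.23) with the main-term constant as a parameter `k`**: for every `ε > 0`, eventually under (A),
`|Ξ₁₁ − k𝔞𝔓| ≤ ε𝔓` (the skeleton's `Eval823 c′` is the instance `k = Re 𝔠₁`). CLAIM-shape, stated not
asserted. [cite: Zhang2022LandauSiegel, §8 (8.23)] -/
def Eval823With (c' : ℝ) (k : ℝ) : Prop :=
  ∀ ε : ℝ, 0 < ε → ForAllLarge fun D _ χ => AssumptionA D χ →
    |xi11 c' χ - k * frakA χ * frakP D| ≤ ε * frakP D

/-- **(10.17) with the cross main-term constant as a parameter `d`**: for every `ε > 0`, eventually under (A),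
`‖Ξ₁* − d𝔞𝔓‖ ≤ ε𝔓` (the skeleton's `Eval1017 c′` is the instance `d = 𝔡′ + 𝔡`). CLAIM-shape, stated not
asserted. [cite: Zhang2022LandauSiegel, §10 (10.17)] -/
def Eval1017With (c' : ℝ) (d : ℂ) : Prop :=
  ∀ ε : ℝ, 0 < ε → ForAllLarge fun D _ χ => AssumptionA D χ →
    ‖xiStar1 c' χ - d * frakA χ * frakP D‖ ≤ ε * frakP D

/-- `Eval823With c′ (Re 𝔠₁)` is the skeleton's `Eval823 c′`. [cite: Zhang2022LandauSiegel, §8 (8.23)] -/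
theorem eval823With_frakc1_iff (c' : ℝ) : Eval823With c' frakc1.re ↔ Eval823 c' := Iff.rfl

/-- `Eval1017With c′ (𝔡′ + 𝔡)` is the skeleton's `Eval1017 c′`. [cite: Zhang2022LandauSiegel, §10 (10.17)] -/
theorem eval1017With_dsum_iff (c' : ℝ) : Eval1017With c' (dprime + dfrak) ↔ Eval1017 c' := Iff.rfl

/-- HAVE (8.23): the tree proves `Eval823With c′ (Re 𝔠₁)` for every large `c′` (conjunct 4 of
`sec2_inputs_hold`). [cite: Zhang2022LandauSiegel, §8 (8.23)] -/
theorem eval823With_have : ∃ cS : ℝ, ∀ c' ≥ cS, Eval823With c' frakc1.re := by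
  obtain ⟨cS, hS⟩ := sec2_inputs_hold
  exact ⟨cS, fun c' hc => (hS c' hc).2.2.2.1⟩

/-- HAVE (10.17): the tree proves `Eval1017With c′ (𝔡′ + 𝔡)` for every large `c′` (conjunct 3 of
`sec2_inputs_hold`). [cite: Zhang2022LandauSiegel, §10 (10.17)] -/
theorem eval1017With_have : ∃ cS : ℝ, ∀ c' ≥ cS, Eval1017With c' (dprime + dfrak) := by
  obtain ⟨cS, hS⟩ := sec2_inputs_hold
  exact ⟨cS, fun c' hc => (hS c' hc).2.2.1⟩

/-- HAVE (9.7): the tree proves the c-reading `Eval97With c′ (Re 𝔠₂ᶜ)` for every large `c′` (conjunct 5 of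
`sec2_inputs_hold`). [cite: Zhang2022LandauSiegel, §9 (9.7)] -/
theorem eval97With_have : ∃ cS : ℝ, ∀ c' ≥ cS, Eval97With c' frakc2c.re := by
  obtain ⟨cS, hS⟩ := sec2_inputs_hold
  exact ⟨cS, fun c' hc => (hS c' hc).2.2.2.2.1⟩

/-! ## Monotonicity in the currency -/

/-- **(2.32)-node is monotone in its constant**: `q₁ ≤ q₂ → Ineq232With c′ q₁ → Ineq232With c′ q₂`
(`𝔞 ≥ a₀ > 0` under (A), `frakALowerBound_holds`; `𝔓 > 0` eventually, `frakP_eventually_pos`). Proof after the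
desk certificate `RepairNodeJunk.lean`. [cite: Zhang2022LandauSiegel, §2 (2.32)] -/
theorem ineq232With_mono {c' q₁ q₂ : ℝ} (hq : q₁ ≤ q₂) (h : Ineq232With c' q₁) : Ineq232With c' q₂ := by
  intro η hη
  obtain ⟨a₀, ha₀, ha⟩ := frakALowerBound_holds
  obtain ⟨D₁, hP⟩ := frakP_eventually_pos
  obtain ⟨D₀, h0⟩ := (h η hη).and ha
  refine ⟨max D₀ D₁, fun D _ χ hD hq' hp hA => ?_⟩
  obtain ⟨h1, h2⟩ := h0 D χ (le_trans (le_max_left _ _) hD) hq' hp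
  have hPpos : 0 < frakP D := hP D (le_trans (le_max_right _ _) hD)
  have hApos : 0 < frakA χ := lt_of_lt_of_le ha₀ (h2 hA)
  have := h1 hA
  nlinarith [mul_pos hApos hPpos]

/-- **(2.33)-node is monotone in its constant**: `c₁ ≤ c₂ → Ineq233With c′ c₁ → Ineq233With c′ c₂`. Proof after
the desk certificate. [cite: Zhang2022LandauSiegel, §2 (2.33)] -/
theorem ineq233With_mono {c' c₁ c₂ : ℝ} (hc : c₁ ≤ c₂) (h : Ineq233With c' c₁) : Ineq233With c' c₂ := by
  intro η hη
  obtain ⟨a₀, ha₀, ha⟩ := frakALowerBound_holds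
  obtain ⟨D₁, hP⟩ := frakP_eventually_pos
  obtain ⟨D₀, h0⟩ := (h η hη).and ha
  refine ⟨max D₀ D₁, fun D _ χ hD hq' hp hA => ?_⟩
  obtain ⟨h1, h2⟩ := h0 D χ (le_trans (le_max_left _ _) hD) hq' hp
  have hPpos : 0 < frakP D := hP D (le_trans (le_max_right _ _) hD)
  have hApos : 0 < frakA χ := lt_of_lt_of_le ha₀ (h2 hA)
  have := h1 hA
  nlinarith [mul_pos hApos hPpos]

/-- **The terminal predicate is antitone in both constants**: for `0 ≤ c₁`, `0 ≤ c₂`, `c₁ ≤ c₁′`, `c₂ ≤ c₂′`,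
`MainOrderContradiction c₁′ c₂′ → MainOrderContradiction c₁ c₂` (smaller node constants close more easily).
[cite: Zhang2022LandauSiegel, §2 after (2.33)] -/
theorem mainOrderContradiction_anti {c₁ c₁' c₂ c₂' : ℝ} (h₁ : 0 ≤ c₁) (h₂ : 0 ≤ c₂) (h₁' : c₁ ≤ c₁')
    (h₂' : c₂ ≤ c₂') (h : MainOrderContradiction c₁' c₂') : MainOrderContradiction c₁ c₂ := by
  unfold MainOrderContradiction at h ⊢
  refine lt_of_le_of_lt (Real.sqrt_le_sqrt ?_) h
  exact mul_le_mul h₁' h₂' h₂ (h₁.trans h₁')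

/-! ## The HAVE side of the (2.32)/(2.33) nodes, as theorems of the tree -/

/-- **(2.32) at every constant `q ≥ c₂₃₂ᴱ`** (`c₂₃₂ᴱ = c232E e1ppD 𝔠₂ᶜ ∈ (0.055348, 0.055363)`): for every large
`c′`, `Ineq232With c′ q` — conjunct 7 of `sec2_inputs_hold` and monotonicity.
[cite: Zhang2022LandauSiegel, §2 (2.32); §18] -/
theorem ineq232With_of_ge {q : ℝ} (hq : c232E e1ppD frakc2c.re ≤ q) :
    ∃ cS : ℝ, ∀ c' ≥ cS, Ineq232With c' q := by
  obtain ⟨cS, hS⟩ := sec2_inputs_hold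
  exact ⟨cS, fun c' hc => ineq232With_mono hq (hS c' hc).2.2.2.2.2.2.1⟩

/-- **(2.33) at every constant `c_J ≥ C₂₃₃`** (`C₂₃₃ ∈ (2546.8476, 2546.8478)`): for every large `c′`,
`Ineq233With c′ c_J`. [cite: Zhang2022LandauSiegel, §2 (2.33); §18 (18.3)] -/
theorem ineq233With_of_ge {cJ : ℝ} (hcJ : C233 ≤ cJ) : ∃ cS : ℝ, ∀ c' ≥ cS, Ineq233With c' cJ := by
  obtain ⟨cS, hS⟩ := sec2_inputs_hold
  exact ⟨cS, fun c' hc => ineq233With_mono hcJ (hS c' hc).2.2.2.2.2.2.2.1⟩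

/-- HAVE (2.32) as a numeral: `Ineq232With c′ 0.055363` for every large `c′`. [cite: Zhang2022LandauSiegel, §2 (2.32)] -/
theorem ineq232With_have : ∃ cS : ℝ, ∀ c' ≥ cS, Ineq232With c' 0.055363 :=
  ineq232With_of_ge c232E_e1ppD_tol_bounds.2.le

/-- HAVE (2.33) as a numeral: `Ineq233With c′ 2546.8478` for every large `c′`. [cite: Zhang2022LandauSiegel, §2 (2.33)] -/
theorem ineq233With_have : ∃ cS : ℝ, ∀ c' ≥ cS, Ineq233With c' 2546.8478 :=
  ineq233With_of_ge C233_bounds.2.le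

/-- The PRINTED constant of (2.33) is on the HAVE side: `Ineq233With c′ 3000` for every large `c′`.
[cite: Zhang2022LandauSiegel, §2 (2.33)] -/
theorem ineq233With_printed : ∃ cS : ℝ, ∀ c' ≥ cS, Ineq233With c' 3000 :=
  ineq233With_of_ge (by linarith [C233_bounds.2])

/-! ## NEEDED vs HAVE in one currency -/

/-- **The gap in currency `q` (the (2.32)-constant), both sides kernel facts**: NEEDED — the terminal step at
`c₂₃₃ = C₂₃₃` fails for every `q ≥ 0.011026` (`not_mainOrderContradiction_C233_of_le`); HAVE — the tree's
constant exceeds `0.055348` (`c232E_e1ppD_tol_bounds`); ratio `> 5.01` (`5.01·0.011026 < 0.055348`).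
[cite: Zhang2022LandauSiegel, §2 (2.32)–(2.33); §18] -/
theorem gap232_numerals :
    (∀ q : ℝ, 0.011026 ≤ q → ¬ MainOrderContradiction q C233) ∧
      (0.055348 : ℝ) < c232E e1ppD frakc2c.re ∧ (5.01 : ℝ) * 0.011026 < 0.055348 :=
  ⟨fun _ hq => not_mainOrderContradiction_C233_of_le hq, by rw [c232E_eq]; exact c232E_e1ppD_tol_bounds.1,
    by norm_num⟩

/-- **The gap in currency `c_J` (the (2.33)-constant) at the tree's `c₂₃₂ᴱ`**: NEEDED — `MainOrderContradiction
c₂₃₂ᴱ c_J` requires `c₂₃₂ᴱ·c_J < ‖𝔡′+𝔡‖² < 28.0792`, impossible for `c_J ≥ 508` (`0.055348·508 > 28.0792`);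
HAVE — `C₂₃₃ > 2546.8476`; ratio `> 5.01`. [cite: Zhang2022LandauSiegel, §2 (2.33); §18 (18.3)] -/
theorem gap233_numerals :
    (∀ cJ : ℝ, 508 ≤ cJ → ¬ MainOrderContradiction (c232E e1ppD frakc2c.re) cJ) ∧
      (2546.8476 : ℝ) < C233 ∧ (5.01 : ℝ) * 508 < 2546.8476 := by
  refine ⟨fun cJ hcJ h => ?_, C233_bounds.1, by norm_num⟩
  have hc : (0.055348 : ℝ) < c232E e1ppD frakc2c.re := by rw [c232E_eq]; exact c232E_e1ppD_tol_bounds.1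
  unfold MainOrderContradiction at h
  rw [Real.sqrt_lt' (lt_trans (by norm_num) Prop24Main_holds), Complex.sq_norm] at h
  have h1 : c232E e1ppD frakc2c.re * 508 ≤ c232E e1ppD frakc2c.re * cJ :=
    mul_le_mul_of_nonneg_left hcJ (by linarith)
  nlinarith [dsum_normSq_bounds.2]

/-- **DEFICIT FACTOR of the terminal row, kernel-certified**: the tree's (2.32)-constant exceeds `5.02` times the
threshold `‖𝔡′+𝔡‖²/C₂₃₃` below which the terminal step would close
(`mainOrderContradiction_iff : MainOrderContradiction q C233 ↔ q < ‖𝔡′+𝔡‖²/C233`):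
`5.02 · ‖𝔡′+𝔡‖²/C₂₃₃ < c₂₃₂ᴱ` (brackets: `‖𝔡′+𝔡‖² < 28.0792`, `C₂₃₃ > 2546.8476`, `c₂₃₂ᴱ > 0.055348`;
`5.03` is NOT certified by these brackets). [cite: Zhang2022LandauSiegel, §2 (2.32)–(2.33); §18] -/
theorem deficit_factor_502 :
    5.02 * (Complex.normSq (dprime + dfrak) / C233) < c232E e1ppD frakc2c.re := by
  have hc : (0.055348 : ℝ) < c232E e1ppD frakc2c.re := by rw [c232E_eq]; exact c232E_e1ppD_tol_bounds.1
  have hC := C233_bounds.1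
  have hN := dsum_normSq_bounds.2
  have hCpos : (0 : ℝ) < C233 := by linarith
  have hdiv : Complex.normSq (dprime + dfrak) / C233 < 28.0792 / 2546.8476 := by
    rw [div_lt_div_iff₀ hCpos (by norm_num)]
    nlinarith [Complex.normSq_nonneg (dprime + dfrak)]
  linarith

/-! ## The exponent-pair currency (GAP rows G-11 / G-32): the ℓ-window feasibility system — kernel twin of the
rescue's kit LP-1 (j271436)

The live form of the `ℓ₀ = 1` knife edge is an exponent window for `(A, B)` (`P = D^A`, `T = D^B`): the printed proof
of (14.8) on the large-conductor range needs `B > 1/2` (`EllRegime.eq148DUniform_of_printedFixedA`; registry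
E-019/E-016), the `T`-power of `P₂` ties `B = r·A` ((2.21); ordered tie `r = 3·10⁻⁴`, print-exact `r = 2·10⁻⁴`,
`EllRegime.TExponentConstraints`), and the cell's census bounds `A` below and above. The census numbers
(`A₀ = 920`, `A_max = 1590`, `c_crit = 0.638`; theory/ELL-CENSUS.md v1.9, labelled HEURISTIC/DERIVATION there) are
NOT facts about `L`-functions and are not asserted here: they enter as ARGUMENTS of a predicate on real numbers, and
what the kernel certifies is the Farkas arithmetic «tie × ceiling ≤ 1/2 ⇒ window empty». Drafted by ls-rescue-quant-1
(scratch `EllWindowLP.lean` 502aa8bdb083f5f9), generalised to explicit parameters here. -/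

/-- **The ℓ-window system with all four numbers explicit**: `1/2 < B` (the (14.8) large-conductor requirement),
the tie `B = r·A` (from `P₂ = P^{ν₂}T^{−10}`, (2.21)), a floor `A₀ ≤ A` and a ceiling `A ≤ A_max·(1 − c/c_crit)`
(`c` = a dictionary-error constant). A predicate on real numbers; nothing is asserted.
[cite: Zhang2022LandauSiegel, §14 (14.8) p.79; §2 (2.21)] -/
def EllWindow (A0 Amax ccrit r c A B : ℝ) : Prop :=
  1 / 2 < B ∧ B = r * A ∧ A0 ≤ A ∧ A ≤ Amax * (1 - c / ccrit)

/-- **Generic emptiness (the LP's Farkas certificate)**: with a non-negative floor, `c ≥ 0`, `c_crit > 0`, `A_max > 0`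
and a tie ratio `r ≤ 1/(2A_max)`, the window is empty: `B = rA ≤ A/(2A_max) ≤ 1/2`.
[cite: Zhang2022LandauSiegel, §14 (14.8) p.79; §2 (2.21)] -/
theorem not_ellWindow_of_ratio_le {A0 Amax ccrit r c A B : ℝ} (hAmax : 0 < Amax) (hA0 : 0 ≤ A0) (hc : 0 ≤ c)
    (hcc : 0 < ccrit) (hr : r ≤ 1 / (2 * Amax)) : ¬ EllWindow A0 Amax ccrit r c A B := by
  rintro ⟨hB, hBA, hA0A, hA⟩
  have hA1 : A ≤ Amax := by
    have hc' : 0 ≤ c / ccrit := div_nonneg hc hcc.le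
    nlinarith
  have hApos : 0 ≤ A := hA0.trans hA0A
  have h1 : B ≤ 1 / (2 * Amax) * A := by rw [hBA]; exact mul_le_mul_of_nonneg_right hr hApos
  have h2 : 1 / (2 * Amax) * A ≤ 1 / 2 := by
    rw [one_div_mul_eq_div, div_le_iff₀ (by positivity)]
    linarith
  linarith

/-- Monotonicity of the window in the ceiling data: a smaller `A_max` or a larger `c` only shrinks it (so an
emptiness certificate at `(A_max, c = 0)` covers every `c ≥ 0` and every smaller ceiling; `A_max ≥ 0`).
[cite: Zhang2022LandauSiegel, §14 (14.8) p.79; §2 (2.21)] -/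
theorem ellWindow_mono {A0 Amax Amax' ccrit r c A B : ℝ} (hAmax : 0 ≤ Amax) (hle : Amax ≤ Amax') (hc : 0 ≤ c)
    (hcc : 0 < ccrit) (h : EllWindow A0 Amax ccrit r c A B) : EllWindow A0 Amax' ccrit r 0 A B := by
  obtain ⟨hB, hBA, hA0A, hA⟩ := h
  refine ⟨hB, hBA, hA0A, ?_⟩
  have h2 : 0 ≤ c / ccrit := div_nonneg hc hcc.le
  rw [zero_div, sub_zero, mul_one]
  nlinarith

/-- **The census instance** (GAP-TABLE G-32 / kit LP-1 j271436): floor `A₀ = 920` (zero-model floor), ceiling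
`1590·(1 − c/0.638)` (ι/ℓ ceiling) — the numbers of theory/ELL-CENSUS.md v1.9 (HEURISTIC/DERIVATION inputs of the
cell, NOT facts about `L`-functions), tie `r`, dictionary constant `c`. [cite: Zhang2022LandauSiegel, §14 (14.8) p.79; §2 (2.21)] -/
def EllWindowV19 (r c A B : ℝ) : Prop := EllWindow 920 1590 0.638 r c A B

/-- **LP-1, ordered tie `r = 3·10⁻⁴`: the census window is empty for every `c ≥ 0`** (`B ≤ 0.477 < 1/2`).
[cite: Zhang2022LandauSiegel, §14 (14.8) p.79; §2 (2.21)] -/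
theorem not_ellWindowV19_ordered {c A B : ℝ} (hc : 0 ≤ c) : ¬ EllWindowV19 (3 / 10000) c A B :=
  not_ellWindow_of_ratio_le (by norm_num) (by norm_num) hc (by norm_num) (by norm_num)

/-- **LP-1, print-exact tie `r = 2·10⁻⁴`: empty for every `c ≥ 0`** (`B ≤ 0.318 < 1/2`).
[cite: Zhang2022LandauSiegel, §14 (14.8) p.79; §2 (2.21)] -/
theorem not_ellWindowV19_printExact {c A B : ℝ} (hc : 0 ≤ c) : ¬ EllWindowV19 (2 / 10000) c A B :=
  not_ellWindow_of_ratio_le (by norm_num) (by norm_num) hc (by norm_num) (by norm_num)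

/-- **Every tie ratio `r ≤ r* = 1/3180 = 1/(2·1590)` leaves the census window empty** (LP-1's elastic threshold).
[cite: Zhang2022LandauSiegel, §14 (14.8) p.79; §2 (2.21)] -/
theorem not_ellWindowV19_of_ratio_le {r c A B : ℝ} (hr : r ≤ 1 / 3180) (hc : 0 ≤ c) :
    ¬ EllWindowV19 r c A B :=
  not_ellWindow_of_ratio_le (by norm_num) (by norm_num) hc (by norm_num) (by norm_num at hr ⊢; linarith)

/-- Conversely the threshold is sharp for the census system at `c = 0`: any `r > 1/3180` admits the point
`A = 1590`, `B = 1590r` (so LP-1's infeasibility is exactly the statement `r ≤ r*`).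
[cite: Zhang2022LandauSiegel, §14 (14.8) p.79; §2 (2.21)] -/
theorem ellWindowV19_of_lt_ratio {r : ℝ} (hr : 1 / 3180 < r) : EllWindowV19 r 0 1590 (r * 1590) := by
  refine ⟨?_, by ring, by norm_num, by norm_num⟩
  norm_num at hr ⊢
  linarith

/-- **The deficits of record** (LP-1): at the ceiling `A = 1590`, `c = 0` the tie gives `B = 0.477` (ordered) resp.
`B = 0.318` (print-exact), i.e. the (14.8) saving `D^{1/2−B}` is short by `D^{0.023}` resp. `D^{0.182}`.
[cite: Zhang2022LandauSiegel, §14 (14.8) p.79; §2 (2.21)] -/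
theorem ellWindowV19_deficits : (3 / 10000 : ℝ) * 1590 = 0.477 ∧ (1 / 2 : ℝ) - 0.477 = 0.023 ∧
    (2 / 10000 : ℝ) * 1590 = 0.318 ∧ (1 / 2 : ℝ) - 0.318 = 0.182 := by norm_num

/-! ## The band-seam currency (GAP row G-21 / optimality audit N17): «no window or scale re-tuning closes the band seam
with the GENERIC multiplicative large sieve» — kernel twin of the quantifier's exponent bookkeeping (rev 3)

Pure exponent arithmetic over `ℝ`; nothing here is a statement about `L`-functions, characters or the large sieve
itself. The exponents are READ from the tree's own docstrings (desk readings, locators below) and enter as DEFINITIONS: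
`log P = 𝓛^{x_P}` ((2.6): `x_P = 9`), prime window `(P, P(1+𝓛^{−w}))` (`w = 68`); the trivial scale of the discrete
mean `discWeight = (8/π)𝓛^{x_P}𝔓` (`KnifeEdgeDiscWeightScale.mainMV_delta1`); the wall-zero band mass
`≤ K²(m+3)³𝓛^{−(2x_P−3)}` (`Repair.coefBlockMass_profCoef_le`, RepairBandMeanValue.lean: height `K(m+2)𝓛^{−(x_P−1)}`
squared × harmonic sum `(m+3)𝓛`); hence the ROOM of `Repair.loss_le_room_eventually` (`κ < 6`) is `x_P − 3`; the
GENERIC multiplicative large sieve loses the family share `𝓛^{w+x_P}` (RepairBandMeanValue module docstring «loses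
𝓛^{77}»). The kernel certifies: deficit `= w + 3`, independent of `x_P`, so `≥ 3` for every `w ≥ 0`. What would close
the seam is ψ-orthogonality across the wall — an ESTIMATE (registry E-108/E-109), not a parameter. Drafted by
ls-rescue-quant-1 g1 (scratch `BandSeamRoom.lean` e0eecb24d77771cd). -/

/-- Exponent of `𝓛` in the wall-zero band-mass bound `K²(m+3)³·𝓛^{−(2x_P−3)}` (height² `𝓛^{−2(x_P−1)}` × harmonic sum
`𝓛¹`; `= 15` at `x_P = 9`; desk reading of `Repair.coefBlockMass_profCoef_le`). [cite: Zhang2022LandauSiegel, §2 (2.30); §7 (7.2) p.44] -/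
def bandMassExp (xP : ℝ) : ℝ := 2 * xP - 3

/-- Exponent of `𝓛` in the trivial scale `discWeight = (8/π)𝓛^{x_P}𝔓` (desk reading of `mainMV_delta1`).
[cite: Zhang2022LandauSiegel, §2 (2.6), (2.9); §7 Prop 7.1] -/
def discWeightExp (xP : ℝ) : ℝ := xP

/-- **The ROOM** of the band reduction: `bandMassExp − discWeightExp` (the largest loss exponent `κ` tolerated,
strictly; `= 6` at `x_P = 9`, the «`κ < 6`» of `Repair.loss_le_room_eventually`). [cite: Zhang2022LandauSiegel, §7 (7.2) p.44] -/
def bandRoom (xP : ℝ) : ℝ := bandMassExp xP - discWeightExp xP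

/-- Loss exponent of the GENERIC multiplicative large sieve on the thin prime window `(P, P(1+𝓛^{−w}))` with
`log P = 𝓛^{x_P}`: the family share `𝓛^{w+x_P}` per prime (desk reading of the RepairBandMeanValue model note «loses 𝓛^{77}»;
the generic inequality is Iwaniec–Kowalski Thm 7.13). [cite: IwaniecKowalski2004, Thm 7.13] -/
def genericLoss (xP w : ℝ) : ℝ := w + xP

/-- The room is `x_P − 3`. [cite: Zhang2022LandauSiegel, §7 (7.2) p.44] -/
theorem bandRoom_eq (xP : ℝ) : bandRoom xP = xP - 3 := by
  unfold bandRoom bandMassExp discWeightExp; ring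

/-- At the printed scale `x_P = 9`: band-mass exponent `15`, room `6` (E-108's «κ < 6»). [cite: Zhang2022LandauSiegel, §2 (2.6); §7 (7.2)] -/
theorem bandRoom_printed : bandMassExp 9 = 15 ∧ bandRoom 9 = 6 := by
  refine ⟨by norm_num [bandMassExp], by norm_num [bandRoom, bandMassExp, discWeightExp]⟩

/-- At the printed window `w = 68`, scale `x_P = 9`: generic loss `77`, deficit `71` powers of `𝓛`.
[cite: Zhang2022LandauSiegel, §2 (2.6), (2.9)] -/
theorem genericLoss_printed : genericLoss 9 68 = 77 ∧ genericLoss 9 68 - bandRoom 9 = 71 := by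
  refine ⟨by norm_num [genericLoss], by norm_num [genericLoss, bandRoom, bandMassExp, discWeightExp]⟩

/-- **The deficit is `w + 3`, independent of the scale exponent `x_P`.** [cite: Zhang2022LandauSiegel, §2 (2.6), (2.9); §7 (7.2)] -/
theorem genericLoss_sub_bandRoom (xP w : ℝ) : genericLoss xP w - bandRoom xP = w + 3 := by
  unfold genericLoss bandRoom bandMassExp discWeightExp; ring

/-- **No window/scale re-tuning closes the seam with the generic tool**: for every `x_P` and every `w ≥ 0` the generic
loss exceeds the room by at least `3` powers of `𝓛`. [cite: Zhang2022LandauSiegel, §2 (2.6), (2.9); §7 (7.2)] -/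
theorem three_le_genericLoss_sub_bandRoom (xP : ℝ) {w : ℝ} (hw : 0 ≤ w) : 3 ≤ genericLoss xP w - bandRoom xP := by
  rw [genericLoss_sub_bandRoom]; linarith

/-- In particular `genericLoss < bandRoom` never holds for `w ≥ 0`. [cite: Zhang2022LandauSiegel, §2 (2.6), (2.9); §7 (7.2)] -/
theorem not_genericLoss_lt_bandRoom (xP : ℝ) {w : ℝ} (hw : 0 ≤ w) : ¬ genericLoss xP w < bandRoom xP := by
  intro h
  have := three_le_genericLoss_sub_bandRoom xP hw
  linarith

/-- The window exponent the generic tool would NEED is negative: `genericLoss x_P w < bandRoom x_P ↔ w < −3`.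
[cite: Zhang2022LandauSiegel, §2 (2.6), (2.9); §7 (7.2)] -/
theorem genericLoss_lt_bandRoom_iff (xP w : ℝ) : genericLoss xP w < bandRoom xP ↔ w < -3 := by
  unfold genericLoss bandRoom bandMassExp discWeightExp
  constructor <;> intro h <;> linarith

end Literature.NumberTheory.LFunctions.Zhang2022.Repair.Gap
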